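import Literature.MathematicalPhysics.QuantumFieldTheory.Balaban1983to89.B13XinvSymLettersOfReg335
import Literature.MathematicalPhysics.QuantumFieldTheory.Balaban1983to89.B13BlockBondReadingNumerals
import Literature.MathematicalPhysics.QuantumFieldTheory.Balaban1983to89.B9Thm39CinvSandwichQ

/-!
# `Balaban1983to89.B13XinvSymLettersOfReg335Located` — T. Bałaban, *Propagators for lattice gauge theories in a background field*, Commun. Math. Phys. **99** (1985)
# 389–434 [Balaban1985BackgroundPropagators], (3.19)–(3.21) pp. 393–394 (`Q′`, `Q′*`), (3.25) p. 394, (3.35) p. 396, Thm 3.2 (3.48) p. 398, (3.66)–(3.70) pp. 403–404, Thm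
# 3.10 (3.107)–(3.108) p. 416; [Balaban1984PropagatorsII] (2.14)–(2.17) p. 225, (2.69) p. 235, Prop 2.3 p. 238; [Balaban1988RG2Cluster] (2.5)–(2.7) pp. 12–13, p. 15:
# ★★★ **THE X⁻¹ KNIT ON THE (3.35) CLASS AT THE READINGS OF RECORD — EVERY DICTIONARY NUMERAL A NUMBER** (the located instance of `B13XinvSymLettersOfReg335`)

statement-level composition of cited tree theorems; kernel-checked; THEOREMS ONLY; nothing of NODE 00's ∕ N06's is modified; nothing here is a claim about the
Yang–Mills mass gap; no node is discharged; count-neutral.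

WHY THIS FILE (cell `pub-ymgap`, D-0062 ∕ D-0149 ∕ D-0154, Track A node N10 = [B13]; width seat `pub-ymgap-dag-n10-w5` g3, the located edition asked for on the bus by
dag-n10-w4 g5 (HOME INBOX l.≈35300: «your `…XinvY_parSymY_prodCfg_of_reg335` is the natural feed for the displayed `hXi` at `blkReadingY`; your numerals would need the same
located treatment»)).  `B13XinvSymLettersOfReg335` §2 displays NODE 00's dictionary numerals as binders (`D′, Cavg` of the averaging; `D_Q, CQ, CQs` of `Q′`; the readings
`ℓS, ℓB` with `s, κr, r`; the fibre bounds `m_S, m_B`).  At the READINGS OF RECORD of dag-n10-w6's `B13SiteReadingNumerals` ∕ `B13BlockBondReadingNumerals` (fine site reading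
`fineReadingY i i.hN`, block reading `blkReadingY i i.hN` on the V1 torus) every one of them is a TREE NUMBER: `D′ = 2(d+1)(L^k − 1)`, `Cavg = 1`, `s = (d+1)L^k`,
`κr = 1∕((d+1)L^k)`, `m_S = m_B = N²` (w6); `D_Q = r = (d+1)(L^k − 1)` (`tdist_chart_blkCornerY_le_of_blkOf_eq`, `hℓQ_blkReadingY`); `CQ = 1` (n06's
`B9Thm39CinvSandwichQ.sum_abs_qpK_le_one`); `CQs = (L^k)^{d+1}` (§1 here: a block has at most `W ≤ (L^k)^{d+1}` sites).  THIS FILE substitutes them: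
* §1 ★ `sum_abs_qpsK_row_le` (`Σ_z |qpsK z s| ≤ (L^k)^{d+1}`: the indicator of the block, `B6Ineq268MultiLevelBox.card_blkOf_le` + `W_eq` + `level_le`); the `Q′`-support
  binders `hD ∕ hDs` are the number `(d+1)(L^k − 1)` inline (`qpK_ne_zero_imp` + w6's `tdist_chart_blkCornerY_le_of_blkOf_eq`).
* §2 ★★★ `rawEntryLetters_toMatrix_XinvY_parSymY_prodCfg_of_reg335_located` — for EVERY `U₀ ∈ (bg9K (M_N ℂ) G i).Reg335 c α₀` (`G ≤ U(N)`, `0 ≤ c·M·α₀`,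
  `c·M·α₀·(d+1) ≤ 1∕16`): `∃ R₁, 0 < R₁ ∧ R₁ ≤ R⋆ ∧ RawEntryLetters (A′ ↦ toMatrix B′ B′ (X⁻¹(e^{iηA′}U₀))) (blkReadingY ∘ fst) R₁ ρ″ (2·B_X)`, `R⋆` = module 79's located
  thin radius at the fine reading (w6's `…_of_reg335_fineReading_record`), `B_X = N³·√((L^k)^{d+1})·4∕(4(d+1)+1)⁻²`; displayed ONLY: the (3.35) data, `η`, `0 < Rc`, and the
  rate chain `0 ≤ ρ′ < δ₀∕((d+1)L^k)`, `0 < μ < ρ′`, `0 ≤ κ ≤ (ρ′−μ)∕4`, `0 ≤ ρ″ < κ` with the ONE 81-shape smallness of `κ` — now an explicit numeric inequality in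
  `(d, L, k, N, η, Rc, ρ′, μ, κ)` — EXACTLY the `hXi` «at `blkReadingY`» of dag-n10-w4's located G-chain.
HONEST FRAMING ∕ SCOPE: substitution of tree numbers into a tree theorem; LOCATED INSTANCE at the fine ∕ block readings — WHICH reading the term tower of record uses is
NODE 00's ∕ def-T's word; scope = n06-w1's (ONE finite lattice operator, rates per lattice step at the coarsest scale; NOT print's multi-scale `d(y,y′)`, NOT (3.48)'s scale
factors `(Lʲη)⁻⁴(Lʲ′η)^{−d}`); nothing of Bałaban's asserted beyond the cited theorems; N06 ∕ N10 NOT discharged; K1⁸ NOT claimed; counts unmoved (typed 28∕28 · discharged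
5∕27); 0 `def`, 0 `sorry`, standard axioms; one finite 𝕋⁴ programme at fixed ε — R4 closes the conditional finite-𝕋⁴ rung `BalabanLadder.UV` only; the YM mass gap (Clay) is
NOT proved by any of this; nothing continuum ∕ ℝ⁴ ∕ OS.

References: T. Bałaban, CMP 99 (1985) 389–434 [Balaban1985BackgroundPropagators] (3.19)–(3.21) pp.393–394, (3.25) p.394, (3.35) p.396, Thm 3.2 (3.48) pp.398–399,
(3.66)–(3.70) pp.403–404, Thm 3.10 (3.107)–(3.108) p.416; CMP 96 (1984) 223–250 [Balaban1984PropagatorsII] (2.14)–(2.17) p.225, (2.69) p.235, Lemma 2.1 (2.61) p.234, Prop 2.3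
p.238; CMP 116 (1988) 1–22 [Balaban1988RG2Cluster] (2.5)–(2.7) pp.12–13, p.15.
-/

noncomputable section

namespace Literature.MathematicalPhysics.QuantumFieldTheory.Balaban1983to89.B13XinvSymLettersOfReg335Located

open Metric Set Finset Module
open scoped Matrix ComplexConjugate Matrix.Norms.L2Operator
open Literature.MathematicalPhysics.QuantumFieldTheory.Balaban1983to89
open Node00 B6KLevelCensusIndexV1 B6Geom246MultiLevelBox B6MultiLevelBoxOperator B6MultiLevelTorusOperator B6GlobalChartV1 B9BackgroundsKLevelV1
open Literature.MathematicalPhysics.QuantumFieldTheory.Balaban1983to89.B4TorusKernel.MultiPeriod (torusSupNorm)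
open Literature.MathematicalPhysics.QuantumFieldTheory.Balaban1983to89.B9Thm37GlueTorus (tdist1)
open Literature.MathematicalPhysics.QuantumFieldTheory.Balaban1983to89.B5TorusCover (UT)
open Literature.MathematicalPhysics.QuantumFieldTheory.Balaban1983to89.B9Eq39Adjoint (prodCfg)
open Literature.MathematicalPhysics.QuantumFieldTheory.Balaban1983to89.B13EntrywiseWalks (RawEntryLetters)
open Literature.MathematicalPhysics.QuantumFieldTheory.Balaban1983to89.B13InverseLettersNeumannRadius (thinRadius_pos thinRadius_le)
open Literature.MathematicalPhysics.QuantumFieldTheory.Balaban1983to89.B13SiteReadingNumerals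
  (fineReadingY hfib_fineReadingY_matrixUnits rawEntryLetters_toMatrix_GpY_parSymY_prodCfg_of_reg335_fineReading_record)
open Literature.MathematicalPhysics.QuantumFieldTheory.Balaban1983to89.B13BlockBondReadingNumerals
  (blkReadingY hℓQ_blkReadingY hℓQs_blkReadingY card_fibre_blkReadingY_matrixUnits tdist_chart_blkCornerY_le_of_blkOf_eq level_le)
open Literature.MathematicalPhysics.QuantumFieldTheory.Balaban1983to89.B9Eq3104CutoffCommutatorSizes (qpK_ne_zero_imp qpsK_ne_zero_imp)
open Literature.MathematicalPhysics.QuantumFieldTheory.Balaban1983to89.B9Thm39CinvSandwichQ (sum_abs_qpK_le_one)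
open Literature.MathematicalPhysics.QuantumFieldTheory.Balaban1983to89.B13XinvSymLettersOfReg335 (rawEntryLetters_toMatrix_XinvY_parSymY_prodCfg_of_letters_located)

variable {d ℓ : ℕ} {hd : 1 ≤ d + 1} {hL : Odd (ℓ + 1) ∧ 1 < ℓ + 1} {b₀ b₁ : ℝ} (i : KIdx d ℓ hd hL b₀ b₁)

/-! ## §1. The X-station's `Q′*` row sum as a number: `CQs = (L^k)^{d+1}` (`D_Q = (d+1)(L^k − 1)` and `CQ = 1` are cited inline in §2) -/

/-- ★ **`Σ_z |qpsK z s| ≤ (L^k)^{d+1}`** — `Q′*`'s kernel is the indicator of the block `Δ(s)`, which has at most `W(s) = (Lʲ)^{d+1} ≤ (L^k)^{d+1}` sites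
(`B6Ineq268MultiLevelBox.card_blkOf_le`, `W_eq`, `level_le`): the X-station's numeral `CQs`. [cite: Balaban1984PropagatorsII, (2.16)–(2.17) p.225, (2.1) p.224, (2.69) p.235] -/
theorem sum_abs_qpsK_row_le (s : BlkY i) : ∑ z, |qpsK i z s| ≤ (((ℓ : ℝ) + 1) ^ i.k) ^ (d + 1) := by
  classical
  have hq : ∀ z : SiteY i, |qpsK i z s| = if blkOf i.D.toDomains z = s then (1 : ℝ) else 0 := fun z => by
    rw [qpsK_eq]
    unfold B6Ineq288MultiLevelTorus.QsM
    split_ifs <;> simp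
  rw [Finset.sum_congr rfl fun z _ => hq z, Finset.sum_ite, Finset.sum_const_zero, add_zero, Finset.sum_const, nsmul_eq_mul, mul_one]
  have h1 := B6Ineq268MultiLevelBox.card_blkOf_le i.D.toDomains s
  rw [B6Ineq268MultiLevelBox.W_eq] at h1
  have hL1 : (1 : ℝ) ≤ (ℓ : ℝ) + 1 := by linarith [Nat.cast_nonneg (α := ℝ) ℓ]
  exact h1.trans (pow_le_pow_left₀ (by positivity) (pow_le_pow_right₀ hL1 (level_le i s)) _)

/-! ## §2. ★★★ The X⁻¹ knit on the (3.35) class at the readings of record -/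

variable {N : ℕ} [NeZero N] {G : Subgroup (Matrix (Fin N) (Fin N) ℂ)ˣ} [DecidableEq (BlkY i)]

/-- ★★★ **THE X⁻¹ KNIT ON THE (3.35) CLASS AT THE READINGS OF RECORD.**  For EVERY `U₀ ∈ (bg9K (M_N ℂ) G i).Reg335 c α₀` (`G ≤ U(N)`, `0 ≤ c·M·α₀`, `c·M·α₀·(d+1) ≤ 1∕16`),
at def-Y's v4 letters and the record's matrix units, with the fine site reading `fineReadingY i i.hN` and the block reading `blkReadingY i i.hN` of dag-n10-w6: `∃ R₁, 0 < R₁ ∧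
R₁ ≤ R⋆ ∧ RawEntryLetters (A′ ↦ toMatrix B′ B′ ((Q′G′²Q′*)⁻¹(e^{iηA′}U₀))) (blkReadingY ∘ fst) R₁ ρ″ (2·(1·1·B_X))` — `B13XinvSymLettersOfReg335.…_of_letters_located` with `G′`'s
letters := module 79 at the fine reading (`…_of_reg335_fineReading_record`) and EVERY dictionary numeral a number (`D_Q = r = (d+1)(L^k − 1)`, `CQ = 1`, `CQs = (L^k)^{d+1}`,
`m_S = m_B = N²`); displayed: the (3.35) data, `η`, `0 < Rc`, the rate chain `0 ≤ ρ′ < δ₀∕((d+1)L^k)` (`δ₀ = 1∕(4(d+2))`), `0 < μ < ρ′`, `0 ≤ κ ≤ (ρ′−μ)∕4` with its ONE explicit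
numeric smallness, `0 ≤ ρ″ < κ`.  LOCATED INSTANCE (which reading is of record is NODE 00's ∕ def-T's word).  [cite: Balaban1985BackgroundPropagators, (3.19)–(3.21) pp.393–394,
(3.25) p.394, (3.35) p.396, Thm 3.2 (3.48) pp.398–399, (3.66)–(3.70) pp.403–404, Thm 3.10 (3.107)–(3.108) p.416; Balaban1984PropagatorsII, Prop 2.3 p.238, Lemma 2.1 (2.61) p.234;
Balaban1988RG2Cluster, (2.5)–(2.7) pp.12–13, p.15] -/
theorem rawEntryLetters_toMatrix_XinvY_parSymY_prodCfg_of_reg335_located (hG : G ≤ B7Prop2Explicit.unitaryUnits (Matrix (Fin N) (Fin N) ℂ))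
    {U₀ : CfgY (Matrix (Fin N) (Fin N) ℂ) i} {c α₀ : ℝ} (hC0 : 0 ≤ c * (kGeo i).M * α₀) (hC1 : c * (kGeo i).M * α₀ * ((d : ℝ) + 1) ≤ 1 / 16)
    (hreg : (bg9K (Matrix (Fin N) (Fin N) ℂ) G i).Reg335 c α₀ U₀)
    (η : ℝ) {Rc : ℝ} (hRc : 0 < Rc) {ρ' : ℝ} (hρ'0 : 0 ≤ ρ')
    (hρ' : ρ' < (1 / (4 * ((d : ℝ) + 2))) * ((((d : ℝ) + 1) * ((((ℓ + 1) ^ i.k : ℕ) : ℝ)))⁻¹))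
    {μ : ℝ} (hμ : 0 < μ) (hμρ : μ < ρ')
    {κ : ℝ} (hκ : 0 ≤ κ) (hκ4 : κ ≤ (ρ' - μ) / 4)
    (hκm : 8 * (Real.sqrt ((((ℓ : ℝ) + 1) ^ i.k) ^ (d + 1)) *
        (1 * (Fintype.card (Fin N × Fin N) : ℝ) *
            (1 * ((1 * Real.exp (|η| * Rc)) ^ ((d + 1) * ((ℓ + 1) ^ i.k - 1)) * 1 * (1 * Real.exp (|η| * Rc)) ^ ((d + 1) * ((ℓ + 1) ^ i.k - 1)))) *
          ((((ℓ : ℝ) + 1) ^ i.k) ^ (d + 1) * (Fintype.card (Fin N × Fin N) : ℝ) *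
            (1 * ((1 * Real.exp (|η| * Rc)) ^ ((d + 1) * ((ℓ + 1) ^ i.k - 1)) * 1 * (1 * Real.exp (|η| * Rc)) ^ ((d + 1) * ((ℓ + 1) ^ i.k - 1))))) *
          ((2 * (1 * 1 * (16 * ((((ℓ + 1) ^ i.k : ℕ) : ℝ)) ^ 2 * Real.sqrt N))) * (2 * (1 * 1 * (16 * ((((ℓ + 1) ^ i.k : ℕ) : ℝ)) ^ 2 * Real.sqrt N))) *
            (((N * N : ℕ) : ℝ) * B6.c0 1 μ ^ (d + 1))) *
          Real.exp (2 * (ρ' - μ) * (((d : ℝ) + 1) * (((((ℓ + 1) ^ i.k : ℕ) : ℝ)) - 1))))) * κ *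
        (((N * N : ℕ) : ℝ) * B6.c0 1 ((ρ' - μ) / 2) ^ (d + 1)) ≤
      ((4 * ((d : ℝ) + 1) + 1) ^ 2)⁻¹ * (ρ' - μ))
    {ρ'' : ℝ} (hρ''0 : 0 ≤ ρ'') (hρ'' : ρ'' < κ) :
    ∃ R₁ : ℝ, 0 < R₁ ∧
      R₁ ≤ Rc / (4 * ((1 * (((d : ℝ) + 1) *
          (1 * Real.exp (|η| * Rc) * (1 * Real.exp (|η| * Rc) * 1 * (1 * Real.exp (|η| * Rc)) + 1) * (1 * Real.exp (|η| * Rc)) +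
            (1 * Real.exp (|η| * Rc) * 1 * (1 * Real.exp (|η| * Rc)) + 1)) +
          1 * ((1 * Real.exp (|η| * Rc)) ^ (2 * (d + 1) * ((ℓ + 1) ^ i.k - 1)) * 1 * (1 * Real.exp (|η| * Rc)) ^ (2 * (d + 1) * ((ℓ + 1) ^ i.k - 1)))) *
            Real.exp ((1 / (4 * ((d : ℝ) + 2)) * ((((d : ℝ) + 1) * ((((ℓ + 1) ^ i.k : ℕ) : ℝ)))⁻¹)) * (((d : ℝ) + 1) * ((((ℓ + 1) ^ i.k : ℕ) : ℝ))))) *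
          (1 * 1 * (16 * ((((ℓ + 1) ^ i.k : ℕ) : ℝ)) ^ 2 * Real.sqrt N)) *
          (((N * N : ℕ) : ℝ) * B6.c0 1 (((1 / (4 * ((d : ℝ) + 2))) * ((((d : ℝ) + 1) * ((((ℓ + 1) ^ i.k : ℕ) : ℝ)))⁻¹) - ρ') / 3) ^ (d + 1)) *
          (((N * N : ℕ) : ℝ) * B6.c0 1 (((1 / (4 * ((d : ℝ) + 2))) * ((((d : ℝ) + 1) * ((((ℓ + 1) ^ i.k : ℕ) : ℝ)))⁻¹) - ρ') / 3) ^ (d + 1))) + 1) ∧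
      RawEntryLetters (fun a : Fin (d + 1) → Site (PV d ℓ i.m i.K hd hL) 0 → Matrix (Fin N) (Fin N) ℂ =>
          LinearMap.toMatrix
            ((Pi.basis fun _ : BlkY i => Matrix.stdBasis ℂ (Fin N) (Fin N)).reindex (Equiv.sigmaEquivProd (BlkY i) (Fin N × Fin N)))
            ((Pi.basis fun _ : BlkY i => Matrix.stdBasis ℂ (Fin N) (Fin N)).reindex (Equiv.sigmaEquivProd (BlkY i) (Fin N × Fin N)))
            (XinvY i (parSymY i) (GpY i (parSymY i)) (prodCfg U₀ η a)))
        (fun p : BlkY i × (Fin N × Fin N) => blkReadingY i i.hN p.1) R₁ ρ''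
        (2 * (1 * 1 * ((N : ℝ) ^ 3 * (Real.sqrt ((((ℓ : ℝ) + 1) ^ i.k) ^ (d + 1)) * (4 / ((4 * ((d : ℝ) + 1) + 1) ^ 2)⁻¹))))) := by
  -- `G′`'s letters at the fine reading (module 79 located by w6) at its thin radius `R⋆ = Rc / (4T + 1)`, `T ≥ 0`
  have hGp := rawEntryLetters_toMatrix_GpY_parSymY_prodCfg_of_reg335_fineReading_record i hG hC0 hC1 hreg η hRc hρ'0 hρ'
  have hT : 0 ≤ (1 * (((d : ℝ) + 1) *
          (1 * Real.exp (|η| * Rc) * (1 * Real.exp (|η| * Rc) * 1 * (1 * Real.exp (|η| * Rc)) + 1) * (1 * Real.exp (|η| * Rc)) +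
            (1 * Real.exp (|η| * Rc) * 1 * (1 * Real.exp (|η| * Rc)) + 1)) +
          1 * ((1 * Real.exp (|η| * Rc)) ^ (2 * (d + 1) * ((ℓ + 1) ^ i.k - 1)) * 1 * (1 * Real.exp (|η| * Rc)) ^ (2 * (d + 1) * ((ℓ + 1) ^ i.k - 1)))) *
            Real.exp ((1 / (4 * ((d : ℝ) + 2)) * ((((d : ℝ) + 1) * ((((ℓ + 1) ^ i.k : ℕ) : ℝ)))⁻¹)) * (((d : ℝ) + 1) * ((((ℓ + 1) ^ i.k : ℕ) : ℝ))))) *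
          (1 * 1 * (16 * ((((ℓ + 1) ^ i.k : ℕ) : ℝ)) ^ 2 * Real.sqrt N)) *
          (((N * N : ℕ) : ℝ) * B6.c0 1 (((1 / (4 * ((d : ℝ) + 2))) * ((((d : ℝ) + 1) * ((((ℓ + 1) ^ i.k : ℕ) : ℝ)))⁻¹) - ρ') / 3) ^ (d + 1)) *
          (((N * N : ℕ) : ℝ) * B6.c0 1 (((1 / (4 * ((d : ℝ) + 2))) * ((((d : ℝ) + 1) * ((((ℓ + 1) ^ i.k : ℕ) : ℝ)))⁻¹) - ρ') / 3) ^ (d + 1)) :=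
    mul_nonneg (mul_nonneg (mul_nonneg
      (mul_nonneg (mul_nonneg zero_le_one (add_nonneg (by positivity) (mul_nonneg zero_le_one (by positivity)))) (Real.exp_pos _).le)
      (by positivity)) (mul_nonneg (Nat.cast_nonneg _) (pow_nonneg (B6RandomWalk.c0_nonneg 1 _) _)))
      (mul_nonneg (Nat.cast_nonneg _) (pow_nonneg (B6RandomWalk.c0_nonneg 1 _) _))
  have hCQs0 : (0 : ℝ) ≤ (((ℓ : ℝ) + 1) ^ i.k) ^ (d + 1) := by positivity
  exact rawEntryLetters_toMatrix_XinvY_parSymY_prodCfg_of_letters_located i hG hreg.1 η (thinRadius_pos hRc hT) (thinRadius_le hRc.le hT)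
    (fun _ _ h => tdist_chart_blkCornerY_le_of_blkOf_eq i (qpK_ne_zero_imp i h)) (fun _ _ h => tdist_chart_blkCornerY_le_of_blkOf_eq i (qpsK_ne_zero_imp i h))
    zero_le_one (sum_abs_qpK_le_one i) hCQs0 (sum_abs_qpsK_row_le i)
    (fineReadingY i i.hN) (blkReadingY i i.hN) (hℓQ_blkReadingY i i.hN) (hℓQs_blkReadingY i i.hN)
    (hfib_fineReadingY_matrixUnits i i.hN) (card_fibre_blkReadingY_matrixUnits i i.hN) hGp hμ hμρ hκ hκ4 hκm hρ''0 hρ''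

end Literature.MathematicalPhysics.QuantumFieldTheory.Balaban1983to89.B13XinvSymLettersOfReg335Located

end
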